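import Literature.MathematicalPhysics.QuantumManyBody.PeriodicHeatFlow
import HarnessLib

/-!
# The periodic heat flow: the Feynman–Kac ground state and the spectral representation on the torus

Topic `Literature/MathematicalPhysics/QuantumManyBody`; sequel of `PeriodicHeatFlow.lean`
(definition item `defn-periodicHeatFlow`, route `BECCovarianceTransport`, whose support item
`TransportBookkeeping` needs the spectral layer of the torus flow `e^{-tH_N^per}`,
`H_N^per = -∑ⱼΔⱼ + ∑_{i<j} v^per(xᵢ - xⱼ)` on `((ℝ/Lℤ)³)^N`). The torus twin of the pair
`GroundStateFeynmanKac.lean` / `HeatFlow.lean` (Dirichlet box): one hypothesis structure, proved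
consequences, and TWO named facts of the standard theory, both stated for BOUNDED periodised
potentials `v^per = periodizedPotential v L ∈ L^∞` (Chung–Zhao's class `q = -V ∈ L^∞ ⊂ J` for the
Brownian motion of the flat torus; note that a bounded `v` of infinite range has `v^per ≡ ∞`, so
boundedness is required of `v^per`, not of `v`).

## Content

* `IsPeriodicGroundStateFK v L Ψ₀` — HYPOTHESIS STRUCTURE "`Ψ₀ : (ℝ³)^N → ℝ` is the (nonnegative,
  `Lℤ³`-periodic, Bose-symmetric, cell-normalised) ground state of `H_N^per`, reached by
  Feynman–Kac": the pointwise eigen-relation `e^{-TH}Ψ₀ = e^{-E₀T}Ψ₀` with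
  `E₀ = periodicGroundStateEnergy v N L` (the variational infimum over the symmetric periodic `C¹`
  core `PeriodicTrialState N L` of `PeriodicBoseGas.lean`), and the ground-state projection
  `e^{E₀T}(e^{-TH}g)(X) → ⟨Ψ₀, g⟩_cell Ψ₀(X)` (`T → ∞`) for every periodic `g ∈ L²(cell)₊` and every
  `X`. Proved: two witnesses coincide (`IsPeriodicGroundStateFK.unique`); the complex-flow readings
  (`periodicHeatFlow` of `Ψ₀` is `e^{-E₀T}Ψ₀`; `e^{E₀T} Re (e^{-TH}f)(X) → ⟨Ψ₀, f⟩_cell Ψ₀(X)`);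
  the canonical term `periodicFKGroundState v N L` (classical choice, junk `0`).
* `PeriodicGroundStateFeynmanKac` — NAMED FACT (Perron–Frobenius–Feynman–Kac package on the torus):
  for `N ≥ 1`, `L > 0`, `v` measurable with `v^per` bounded, a witness exists, is continuous and
  strictly positive everywhere.
* `PeriodicHeatFlowSpectralMeasure` — NAMED FACT (spectral theorem for the torus Hamiltonian read
  through the flow): for `L > 0`, `v` measurable with `v^per` bounded and periodic measurable data
  `ψ₀ ∈ L²(cell)`, there is a finite positive measure `μ` on `[0, ∞)` of mass `‖ψ₀‖²_cell` with
  `⟨ψ₀, e^{-tH}ψ₀⟩_cell = ∫ e^{-tλ} dμ(λ)` and `‖e^{-tH}ψ₀‖²_cell = ∫ e^{-2tλ} dμ(λ)` (`t ≥ 0`);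
  proved corollary: **log-convexity** `Z((s+t)/2)² ≤ Z(s) Z(t)` of `Z(t) = ‖e^{-tH}ψ₀‖²_cell`
  (`PeriodicHeatFlowSpectralMeasure.sq_le_mul`, Cauchy–Schwarz in `dμ`).

## Sources and the derivations behind the two facts

Chung–Zhao [ChungZhao1995] §3.2 is written for a Hunt process `X` on a locally compact metric space
`S` whose transition function has a symmetric bounded density with respect to a `σ`-finite
measure `m` ((25)) and a potential `q` of class (13) (e.g. `q ∈ L^∞`): the Feynman–Kac semigroup
`T_t f(x) = E^x{e_q(t) f(X_t)}` ((26)) is a semigroup of positive operators on every `L^p(S, m)`,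
bounded `L^p → L^∞`, with a SYMMETRIC bounded density `u_t`, strongly continuous when `P_t` is
(Thm 3.10), strong Feller when `P_t` is (Props 3.11–3.13), compact on `L²` when `m(S) < ∞`
(Prop 3.15). Here `S = ((ℝ/Lℤ)³)^N` (compact), `X` = the projection of the world-lines
`X + √2 b` (Brownian motion of the flat torus at speed `2`; its transition density, the periodised
Gaussian, is symmetric, bounded and strictly positive for `t > 0`), `m` = Haar = Lebesgue measure
of the cell, `q = -∑_{i<j} v^per(xᵢ-xⱼ) ∈ L^∞`; periodic functions on `(ℝ³)^N` are the functions on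
`S`, and for them `periodicFKSemigroup` / `periodicHeatFlow` IS (26) (Freidlin [Freidlin1985],
Ch. VII §7.2 (2.12)–(2.13): the periodic-coefficient Feynman–Kac semigroup on the space `C_π` of
periodic functions is the semigroup of the projected process on the torus `T^r`, with the same
generator on periodic `C²` functions).
* `PeriodicHeatFlowSpectralMeasure`: the semigroup (26) on `L²(S, m)` is strongly continuous,
  symmetric (Thm 3.10), a contraction since `q ≤ 0`, hence `T_t = e^{-tH}` for a self-adjoint
  `H ≥ 0`; the functional calculus `⟨φ, g(H)φ⟩ = ∫ g dμ_φ`, `‖g(H)φ‖² = ∫ |g|² dμ_φ`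
  (Reed–Simon I, Thm VIII.5 [ReedSimonI1980]) with `g(λ) = e^{-tλ}`.
* `PeriodicGroundStateFeynmanKac`: `T_t` is compact self-adjoint and positivity improving on
  `L²(S)` (`u_t ≥ e^{-t‖q‖_∞} p_t > 0`), so `E₀ = inf σ(H)` is a simple eigenvalue with a strictly
  positive eigenfunction (Reed–Simon IV, Thm XIII.44 [ReedSimonIV1978]; Glimm–Jaffe Thms
  3.3.2–3.3.3; on the torus with continuous data also Freidlin Ch. VII §7.2: Doeblin's condition,
  "`e^{tλ}` is a simple eigenvalue of `Q_t` with strictly positive eigenfunction"); uniqueness ⇒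
  permutation symmetry, and the symmetric periodic `C¹` functions are a form core of the symmetric
  sector, so `inf σ(H) = periodicGroundStateEnergy v N L` (Reed–Simon IV §XIII.12, remark after
  Thm XIII.46); continuity and the pointwise relations via `T_t : L² → C(S)` (Props 3.12–3.13);
  spectral gap (compact resolvent) ⇒ `e^{tE₀}e^{-tH}g → ⟨Ψ₀, g⟩Ψ₀` in `L²` (Glimm–Jaffe (3.4.2)),
  pointwise via `T_1 : L² → L^∞`.

## What is NOT here

Hard cores (`v = ⊤` on a set of radii): both facts are stated for bounded `v^per` only (with hard
cores the accessible region of the torus may be disconnected and the ground state degenerate; the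
spectral representation then holds for `t > 0` with mass `≤ ‖ψ₀‖²_cell` and should be PROVED from the
semigroup law, the symmetry and the Hilbert–Schmidt bound, as for the Dirichlet flow). The proofs
of the two facts (the torus analogues of `HeatFlowProofs.lean` and `GroundStateFeynmanKacProofs.lean`)
are left to provefact seats.
-/

noncomputable section

open MeasureTheory Filter Metric
open scoped ENNReal NNReal Topology ComplexConjugate

namespace Literature.MathematicalPhysics.QuantumManyBody.BoseGas

variable {N : ℕ}

/-! ### The ground state through Feynman–Kac (torus) -/

/-- **`Ψ₀` is the ground state of the torus Hamiltonian `H_N^per`, in Feynman–Kac form**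
(hypothesis structure). `Ψ₀ : (ℝ³)^N → ℝ` is measurable, nonnegative, `Lℤ³`-periodic in every
particle (stated on the generators `L e_{i,k}`), permutation symmetric and normalised on the
fundamental cell `[0,L)^{3N}`; the variational ground-state energy
`E₀ = periodicGroundStateEnergy v N L` (infimum over the symmetric periodic `C¹` core) is finite;
`Ψ₀` is a pointwise eigenfunction of the periodic Feynman–Kac functional,
`e^{-TH}Ψ₀ = e^{-E₀T}Ψ₀` (so `E₀ = inf σ(H_N^per)` is attained); and `Ψ₀` is the Feynman–Kac
limit: for every periodic measurable `g ≥ 0` with `∫_cell g² < ∞` and every `X`,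
`e^{E₀T} E_X[e^{-∫₀ᵀ∑v^per} g(B_T)] → ⟨Ψ₀, g⟩_cell Ψ₀(X)` as `T → ∞` (rank-one ground-state
projection: nondegeneracy and a spectral gap). Any two witnesses coincide
(`IsPeriodicGroundStateFK.unique`). For bounded `v^per` a witness exists
(`PeriodicGroundStateFeynmanKac`). `N` is implicit in `Ψ₀`.
[cite: GlimmJaffeQP1987, §3.3 Thm 3.3.2 and §3.4 (3.4.2)] -/
structure IsPeriodicGroundStateFK {N : ℕ} (v : ℝ → ℝ≥0∞) (L : ℝ) (Ψ₀ : Config N → ℝ) : Prop where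
  /-- `Ψ₀` is Borel measurable. -/
  measurable : Measurable Ψ₀
  /-- `Ψ₀ ≥ 0` (the Perron–Frobenius choice of phase). -/
  nonneg : ∀ X, 0 ≤ Ψ₀ X
  /-- Periodicity: `Ψ₀(…, xᵢ + L e_k, …) = Ψ₀(…, xᵢ, …)` for every particle `i` and axis `k`. -/
  periodic : ∀ (X : Config N) (i : Fin N) (k : Fin 3),
    Ψ₀ (X + Pi.single i (EuclideanSpace.single k L)) = Ψ₀ X
  /-- Bose symmetry (automatic for the nondegenerate absolute ground state). -/
  symm : ∀ (σ : Equiv.Perm (Fin N)) (X : Config N), Ψ₀ (X ∘ σ) = Ψ₀ X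
  /-- Normalisation on the fundamental cell `∫_{[0,L)^{3N}} Ψ₀² = 1`. -/
  norm_eq : ∫⁻ X in cellN N L, ENNReal.ofReal (Ψ₀ X) ^ 2 = 1
  /-- The variational periodic ground-state energy is finite. -/
  energy_ne_top : periodicGroundStateEnergy v N L ≠ ⊤
  /-- Eigen-relation `(e^{-TH} Ψ₀)(X) = e^{-E₀ T} Ψ₀(X)` for all `T ≥ 0` and all `X`, with
  `E₀ = periodicGroundStateEnergy v N L`. -/
  eigen : ∀ T : ℝ, 0 ≤ T → ∀ X : Config N,
    periodicFKSemigroup v L T (fun Y => ENNReal.ofReal (Ψ₀ Y)) X =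
      ENNReal.ofReal (Real.exp (-((periodicGroundStateEnergy v N L).toReal * T)) * Ψ₀ X)
  /-- Ground-state projection: `e^{E₀T} (e^{-TH} g)(X) → ⟨Ψ₀, g⟩_cell Ψ₀(X)` for periodic
  `g ∈ L²(cell)₊` and all `X`. -/
  tendsto : ∀ g : Config N → ℝ≥0∞, Measurable g →
    (∀ (X : Config N) (i : Fin N) (k : Fin 3),
      g (X + Pi.single i (EuclideanSpace.single k L)) = g X) →
    ∫⁻ Y in cellN N L, g Y ^ 2 ≠ ⊤ → ∀ X : Config N,
    Tendsto (fun T : ℝ => ENNReal.ofReal (Real.exp ((periodicGroundStateEnergy v N L).toReal * T)) *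
      periodicFKSemigroup v L T g X) atTop
      (𝓝 ((∫⁻ Y in cellN N L, ENNReal.ofReal (Ψ₀ Y) * g Y) * ENNReal.ofReal (Ψ₀ X)))

/-- **Ground-state Feynman–Kac theorem on the torus, bounded periodised potentials** (named
fact). For `N ≥ 1` particles on the torus of side `L > 0` with a measurable repulsive radial pair
potential `v : ℝ → [0, ∞]` whose periodisation `v^per = ∑_{n∈ℤ³} v(|· - Ln|)` is BOUNDED, the
Hamiltonian `H_N^per = -∑Δᵢ + ∑_{i<j} v^per(xᵢ-xⱼ)` on `((ℝ/Lℤ)³)^N` has a unique cell-normalised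
nonnegative ground state `Ψ₀`; it is continuous, strictly positive, permutation symmetric, its
energy is the variational infimum `periodicGroundStateEnergy v N L`, and it is the Feynman–Kac
limit `e^{E₀T}(e^{-TH}g)(X) → ⟨Ψ₀, g⟩_cell Ψ₀(X)` (`IsPeriodicGroundStateFK`). Assembly of: the
Feynman–Kac semigroup (26) of the Brownian motion of the flat torus (symmetric bounded strictly
positive transition density, `m(S) < ∞`) with `q = -V^per ∈ L^∞` — positive, symmetric,
`L² → L^∞`, strong Feller, compact (Chung–Zhao Thm 3.10, Props 3.11–3.15); positivity improving
+ compactness ⇒ simple strictly positive ground state (Reed–Simon IV Thm XIII.44; Glimm–Jaffe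
Thms 3.3.2–3.3.3; Freidlin Ch. VII §7.2 on the torus), hence Bose symmetric with symmetric
variational infimum `= inf σ(H)` (Reed–Simon IV §XIII.12, remark after Thm XIII.46); spectral gap
⇒ `e^{tE₀}e^{-tH}g → ⟨Ψ₀,g⟩Ψ₀` (Glimm–Jaffe (3.4.2)), pointwise and continuity via
`T_t : L² → C(S)`.
[cite: ChungZhao1995, §3.2 (26), Thm 3.10 and Props 3.11–3.15; ReedSimonIV1978, Thm XIII.44] -/
def PeriodicGroundStateFeynmanKac : Prop :=
  ∀ (N : ℕ) (L : ℝ) (v : ℝ → ℝ≥0∞), 1 ≤ N → 0 < L → Measurable v →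
    (∃ C : ℝ≥0, ∀ x, periodizedPotential v L x ≤ C) →
    ∃ Ψ₀ : Config N → ℝ, IsPeriodicGroundStateFK v L Ψ₀ ∧ Continuous Ψ₀ ∧ ∀ X, 0 < Ψ₀ X

/-! ### Consequences of `IsPeriodicGroundStateFK` -/

namespace IsPeriodicGroundStateFK

variable {v : ℝ → ℝ≥0∞} {L : ℝ} {Ψ₀ Φ : Config N → ℝ}

/-- A witness has finite (unit) mass on the cell. [folklore] -/
theorem setLIntegral_sq_ne_top (h : IsPeriodicGroundStateFK v L Ψ₀) :
    ∫⁻ X in cellN N L, ENNReal.ofReal (Ψ₀ X) ^ 2 ≠ ⊤ := by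
  rw [h.norm_eq]; exact ENNReal.one_ne_top

/-- The complexification of a witness is periodic. [folklore] -/
theorem ofReal_periodic (h : IsPeriodicGroundStateFK v L Ψ₀) (X : Config N) (i : Fin N)
    (k : Fin 3) :
    ENNReal.ofReal (Ψ₀ (X + Pi.single i (EuclideanSpace.single k L))) = ENNReal.ofReal (Ψ₀ X) := by
  rw [h.periodic]

/-- Along a second witness `Φ` the renormalised functional is constant:
`e^{E₀T} (e^{-TH} Φ)(X) = Φ(X)` for `T ≥ 0`. [folklore] -/
theorem ofReal_exp_mul_periodicFKSemigroup (h : IsPeriodicGroundStateFK v L Φ) {T : ℝ}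
    (hT : 0 ≤ T) (X : Config N) :
    ENNReal.ofReal (Real.exp ((periodicGroundStateEnergy v N L).toReal * T)) *
        periodicFKSemigroup v L T (fun Y => ENNReal.ofReal (Φ Y)) X = ENNReal.ofReal (Φ X) := by
  rw [h.eigen T hT X, ← ENNReal.ofReal_mul (Real.exp_pos _).le, ← mul_assoc, ← Real.exp_add,
    add_neg_cancel, Real.exp_zero, one_mul]

/-- **Uniqueness of the periodic Feynman–Kac ground state.** Two witnesses of
`IsPeriodicGroundStateFK v L` coincide (the projection limit of the first, tested on the second,
an exact eigenfunction, forces `Φ = ⟨Ψ₀, Φ⟩_cell Ψ₀`; normalisation gives `⟨Ψ₀, Φ⟩_cell = 1`).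
[folklore] -/
theorem unique (h₁ : IsPeriodicGroundStateFK v L Ψ₀) (h₂ : IsPeriodicGroundStateFK v L Φ) :
    Ψ₀ = Φ := by
  -- the overlap `c = ⟨Ψ₀, Φ⟩_cell`
  set c : ℝ≥0∞ := ∫⁻ Y in cellN N L, ENNReal.ofReal (Ψ₀ Y) * ENNReal.ofReal (Φ Y) with hc
  -- Step 1: `Φ = c • Ψ₀` pointwise (in `[0, ∞]`)
  have hpt : ∀ X, ENNReal.ofReal (Φ X) = c * ENNReal.ofReal (Ψ₀ X) := by
    intro X
    have hlim := h₁.tendsto (fun Y => ENNReal.ofReal (Φ Y)) h₂.measurable.ennreal_ofReal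
      h₂.ofReal_periodic h₂.setLIntegral_sq_ne_top X
    have hconst : (fun T : ℝ =>
        ENNReal.ofReal (Real.exp ((periodicGroundStateEnergy v N L).toReal * T)) *
          periodicFKSemigroup v L T (fun Y => ENNReal.ofReal (Φ Y)) X) =ᶠ[atTop]
        fun _ => ENNReal.ofReal (Φ X) :=
      (eventually_ge_atTop 0).mono fun T hT => h₂.ofReal_exp_mul_periodicFKSemigroup hT X
    exact tendsto_nhds_unique (tendsto_const_nhds.congr' hconst.symm) hlim
  -- Step 2: `c ≠ ⊤` (`ab ≤ a² + b²`)
  have hc_top : c ≠ ⊤ := by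
    refine ne_top_of_le_ne_top
      (ENNReal.add_ne_top.2 ⟨h₁.setLIntegral_sq_ne_top, h₂.setLIntegral_sq_ne_top⟩) ?_
    rw [← lintegral_add_left (h₁.measurable.ennreal_ofReal.pow_const 2)]
    refine lintegral_mono fun Y => ?_
    rcases le_total (ENNReal.ofReal (Ψ₀ Y)) (ENNReal.ofReal (Φ Y)) with hle | hle
    · calc ENNReal.ofReal (Ψ₀ Y) * ENNReal.ofReal (Φ Y)
          ≤ ENNReal.ofReal (Φ Y) * ENNReal.ofReal (Φ Y) := mul_le_mul' hle le_rfl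
        _ = ENNReal.ofReal (Φ Y) ^ 2 := (sq _).symm
        _ ≤ _ := le_add_self
    · calc ENNReal.ofReal (Ψ₀ Y) * ENNReal.ofReal (Φ Y)
          ≤ ENNReal.ofReal (Ψ₀ Y) * ENNReal.ofReal (Ψ₀ Y) := mul_le_mul' le_rfl hle
        _ = ENNReal.ofReal (Ψ₀ Y) ^ 2 := (sq _).symm
        _ ≤ _ := le_self_add
  -- Step 3: `c = 1` from the normalisations
  have hc1 : c = 1 := by
    have h2 : c ^ 2 = 1 := by
      have := h₂.norm_eq
      simp_rw [hpt, mul_pow] at this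
      rwa [lintegral_const_mul _ (h₁.measurable.ennreal_ofReal.pow_const 2), h₁.norm_eq,
        mul_one] at this
    have := (ENNReal.pow_right_strictMono two_ne_zero).injective (a₁ := c) (a₂ := 1)
    exact this (by simpa using h2)
  -- Step 4: conclude in `ℝ`
  funext X
  have := hpt X
  rw [hc1, one_mul] at this
  exact ((ENNReal.ofReal_eq_ofReal_iff (h₂.nonneg X) (h₁.nonneg X)).1 this).symm

/-- **The complex flow of the ground state**: `e^{-TH}Ψ₀ = e^{-E₀T}Ψ₀` read through
`periodicHeatFlow` (measurable `v`, `T ≥ 0`). [folklore] -/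
theorem periodicHeatFlow_ofReal (h : IsPeriodicGroundStateFK v L Ψ₀) (hv : Measurable v) {T : ℝ}
    (hT : 0 ≤ T) (X : Config N) :
    periodicHeatFlow v N L T (fun Y => (Ψ₀ Y : ℂ)) X =
      ((Real.exp (-((periodicGroundStateEnergy v N L).toReal * T)) * Ψ₀ X : ℝ) : ℂ) := by
  rw [periodicHeatFlow_ofReal_eq_periodicFKSemigroup hv L T h.measurable h.nonneg X, h.eigen T hT X,
    ENNReal.toReal_ofReal (mul_nonneg (Real.exp_pos _).le (h.nonneg X))]

/-- **The ground-state projection of the complex flow**: for nonnegative measurable periodic data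
`f` with `∫_cell f² < ∞`, `e^{E₀T} Re (e^{-TH} f)(X) → ⟨Ψ₀, f⟩_cell Ψ₀(X)` as `T → ∞`, for every
`X` (the structure's `tendsto`, read through `periodicHeatFlow_ofReal_eq_periodicFKSemigroup`).
[folklore] -/
theorem tendsto_exp_mul_re_periodicHeatFlow (h : IsPeriodicGroundStateFK v L Ψ₀) (hv : Measurable v)
    {f : Config N → ℝ} (hf : Measurable f) (h0 : ∀ Y, 0 ≤ f Y)
    (hper : ∀ (Y : Config N) (i : Fin N) (k : Fin 3),
      f (Y + Pi.single i (EuclideanSpace.single k L)) = f Y)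
    (h2 : ∫⁻ Y in cellN N L, ENNReal.ofReal (f Y) ^ 2 ≠ ⊤) (X : Config N) :
    Tendsto (fun T : ℝ => Real.exp ((periodicGroundStateEnergy v N L).toReal * T) *
        (periodicHeatFlow v N L T (fun Y => (f Y : ℂ)) X).re) atTop
      (𝓝 ((∫ Y in cellN N L, Ψ₀ Y * f Y) * Ψ₀ X)) := by
  have hgm : Measurable fun Y => ENNReal.ofReal (f Y) := ENNReal.measurable_ofReal.comp hf
  have hlim := h.tendsto (fun Y => ENNReal.ofReal (f Y)) hgm (fun Y i k => by rw [hper]) h2 X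
  -- the limit is finite: `⟨Ψ₀, f⟩_cell ≤ ‖Ψ₀‖ ‖f‖ < ∞` (Cauchy–Schwarz on the cell)
  have hinner : ∫⁻ Y in cellN N L, ENNReal.ofReal (Ψ₀ Y) * ENNReal.ofReal (f Y) ≠ ⊤ := by
    have hcs := ENNReal.lintegral_mul_le_Lp_mul_Lq (volume.restrict (cellN N L))
      Real.HolderConjugate.two_two h.measurable.ennreal_ofReal.aemeasurable hgm.aemeasurable
    simp only [Pi.mul_apply, ENNReal.rpow_two, h.norm_eq, ENNReal.one_rpow, one_mul] at hcs
    exact ne_top_of_le_ne_top (ENNReal.rpow_ne_top_of_nonneg (by positivity) h2) hcs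
  have hlim' := (ENNReal.tendsto_toReal (ENNReal.mul_ne_top hinner ENNReal.ofReal_ne_top)).comp
    hlim
  have hfk : ∀ T : ℝ, (ENNReal.ofReal (Real.exp ((periodicGroundStateEnergy v N L).toReal * T)) *
      periodicFKSemigroup v L T (fun Y => ENNReal.ofReal (f Y)) X).toReal =
      Real.exp ((periodicGroundStateEnergy v N L).toReal * T) *
        (periodicHeatFlow v N L T (fun Y => (f Y : ℂ)) X).re := by
    intro T
    rw [ENNReal.toReal_mul, ENNReal.toReal_ofReal (Real.exp_pos _).le,
      periodicHeatFlow_ofReal_eq_periodicFKSemigroup hv L T hf h0 X, Complex.ofReal_re]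
  have hl : ((∫⁻ Y in cellN N L, ENNReal.ofReal (Ψ₀ Y) * ENNReal.ofReal (f Y)) *
      ENNReal.ofReal (Ψ₀ X)).toReal = (∫ Y in cellN N L, Ψ₀ Y * f Y) * Ψ₀ X := by
    rw [ENNReal.toReal_mul, ENNReal.toReal_ofReal (h.nonneg X)]
    congr 1
    rw [integral_eq_lintegral_of_nonneg_ae
      (Eventually.of_forall fun Y => mul_nonneg (h.nonneg Y) (h0 Y))
      ((h.measurable.mul hf).aestronglyMeasurable)]
    congr 1
    exact lintegral_congr fun Y => by rw [ENNReal.ofReal_mul (h.nonneg Y)]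
  simpa only [Function.comp_def, hfk, hl] using hlim'

end IsPeriodicGroundStateFK

/-! ### The canonical periodic Feynman–Kac ground state as a term -/

/-- **The** periodic Feynman–Kac ground state `Ψ₀ = periodicFKGroundState v N L : (ℝ³)^N → ℝ` of
`N` particles on the torus of side `L` with pair potential `v`: the witness of
`IsPeriodicGroundStateFK v L` chosen by classical choice when one exists (it is then unique,
`IsPeriodicGroundStateFK.unique`). **Junk value** `0` when no witness exists (degenerate or absent
ground state). [folklore] -/
def periodicFKGroundState (v : ℝ → ℝ≥0∞) (N : ℕ) (L : ℝ) : Config N → ℝ :=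
  open Classical in
  if h : ∃ Ψ₀ : Config N → ℝ, IsPeriodicGroundStateFK v L Ψ₀ then h.choose else 0

/-- If a witness exists, `periodicFKGroundState` is one. [folklore] -/
theorem isPeriodicGroundStateFK_periodicFKGroundState {v : ℝ → ℝ≥0∞} {N : ℕ} {L : ℝ}
    (h : ∃ Ψ₀ : Config N → ℝ, IsPeriodicGroundStateFK v L Ψ₀) :
    IsPeriodicGroundStateFK v L (periodicFKGroundState v N L) := by
  rw [periodicFKGroundState, dif_pos h]
  exact h.choose_spec

/-- Without a witness, `periodicFKGroundState` is the junk value `0`. [folklore] -/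
theorem periodicFKGroundState_of_not {v : ℝ → ℝ≥0∞} {N : ℕ} {L : ℝ}
    (h : ¬ ∃ Ψ₀ : Config N → ℝ, IsPeriodicGroundStateFK v L Ψ₀) :
    periodicFKGroundState v N L = 0 := by
  rw [periodicFKGroundState, dif_neg h]

/-- Every witness IS the canonical one (uniqueness). [folklore] -/
theorem IsPeriodicGroundStateFK.eq_periodicFKGroundState {v : ℝ → ℝ≥0∞} {N : ℕ} {L : ℝ}
    {Ψ₀ : Config N → ℝ} (h : IsPeriodicGroundStateFK v L Ψ₀) :
    Ψ₀ = periodicFKGroundState v N L :=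
  h.unique (isPeriodicGroundStateFK_periodicFKGroundState ⟨Ψ₀, h⟩)

/-- `periodicFKGroundState ≥ 0` (in both branches). [folklore] -/
theorem periodicFKGroundState_nonneg (v : ℝ → ℝ≥0∞) (N : ℕ) (L : ℝ) (X : Config N) :
    0 ≤ periodicFKGroundState v N L X := by
  by_cases h : ∃ Ψ₀ : Config N → ℝ, IsPeriodicGroundStateFK v L Ψ₀
  · exact (isPeriodicGroundStateFK_periodicFKGroundState h).nonneg X
  · simp [periodicFKGroundState_of_not h]

/-- Under the named fact, for measurable `v` with bounded `v^per`, `N ≥ 1`, `L > 0`: the canonical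
periodic Feynman–Kac ground state is a witness, continuous, and strictly positive.
[cite: ChungZhao1995, §3.2 (26), Thm 3.10 and Props 3.11–3.15; ReedSimonIV1978, Thm XIII.44] -/
theorem PeriodicGroundStateFeynmanKac.periodicFKGroundState (hGS : PeriodicGroundStateFeynmanKac)
    {N : ℕ} {L : ℝ} {v : ℝ → ℝ≥0∞} (hN : 1 ≤ N) (hL : 0 < L) (hv : Measurable v)
    (hb : ∃ C : ℝ≥0, ∀ x, periodizedPotential v L x ≤ C) :
    IsPeriodicGroundStateFK v L (periodicFKGroundState v N L) ∧
      Continuous (periodicFKGroundState v N L) ∧ ∀ X, 0 < periodicFKGroundState v N L X := by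
  obtain ⟨Ψ₀, hΨ, hcont, hpos⟩ := hGS N L v hN hL hv hb
  obtain rfl := hΨ.eq_periodicFKGroundState
  exact ⟨hΨ, hcont, hpos⟩

/-! ### Named fact: the spectral representation on the torus (bounded periodised potentials) -/

/-- **Spectral representation of the periodic heat flow** (named fact; the spectral theorem for the
torus Hamiltonian read through the flow). For `L > 0`, a measurable pair potential `v ≥ 0` whose
periodisation `v^per` is BOUNDED, and measurable data `ψ₀` that are `Lℤ³`-periodic in every
particle with `∫_cell |ψ₀|² < ∞`, there is a finite positive Borel measure `μ` on `ℝ` carried by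
`[0, ∞)`, of total mass `∫_cell |ψ₀|²`, with `⟨ψ₀, e^{-tH}ψ₀⟩_cell = ∫ e^{-tλ} dμ(λ)` and
`‖e^{-tH}ψ₀‖²_cell = ∫ e^{-2tλ} dμ(λ)` for all `t ≥ 0` (`μ` = the spectral measure of `ψ₀|_cell` for
`H_N^per ≥ 0`). Assembly of: the Feynman–Kac semigroup (26) of the Brownian motion of the flat torus
`S = ((ℝ/Lℤ)³)^N` with `q = -V^per ∈ L^∞` is a strongly continuous symmetric semigroup on
`L²(S)` (Chung–Zhao Thm 3.10; the periodic-coefficient semigroup on periodic functions is the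
torus semigroup, Freidlin Ch. VII §7.2 (2.12)–(2.13)), a contraction since `q ≤ 0`, hence
`T_t = e^{-tH}` with `H` self-adjoint, `H ≥ 0`; and the functional calculus
`⟨φ, g(H)φ⟩ = ∫ g dμ_φ`, `‖g(H)φ‖² = ∫ |g|² dμ_φ` (Reed–Simon I, Thm VIII.5 (a) and (VIII.4)).
[cite: ChungZhao1995, §3.2 (26) and Thm 3.10; ReedSimonI1980, Thm VIII.5] -/
def PeriodicHeatFlowSpectralMeasure : Prop :=
  ∀ (N : ℕ) (L : ℝ) (v : ℝ → ℝ≥0∞), 0 < L → Measurable v →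
    (∃ C : ℝ≥0, ∀ x, periodizedPotential v L x ≤ C) →
    ∀ ψ₀ : Config N → ℂ, Measurable ψ₀ →
      (∀ (X : Config N) (i : Fin N) (k : Fin 3),
        ψ₀ (X + Pi.single i (EuclideanSpace.single k L)) = ψ₀ X) →
      ∫⁻ X in cellN N L, ‖ψ₀ X‖ₑ ^ 2 ≠ ⊤ →
      ∃ μ : Measure ℝ, IsFiniteMeasure μ ∧ μ (Set.Iio 0) = 0 ∧
        μ Set.univ = ∫⁻ X in cellN N L, ‖ψ₀ X‖ₑ ^ 2 ∧
        (∀ t : ℝ, 0 ≤ t →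
          ∫ X in cellN N L, conj (ψ₀ X) * periodicHeatFlow v N L t ψ₀ X =
            ∫ E, (Real.exp (-(t * E)) : ℂ) ∂μ) ∧
        ∀ t : ℝ, 0 ≤ t →
          ∫⁻ X in cellN N L, ‖periodicHeatFlow v N L t ψ₀ X‖ₑ ^ 2 =
            ∫⁻ E, ENNReal.ofReal (Real.exp (-(2 * t * E))) ∂μ

/-- **Log-convexity of `Z(t) = ‖e^{-tH}ψ₀‖²_cell`** under the spectral representation:
`Z((s+t)/2)² ≤ Z(s) · Z(t)` for `s, t ≥ 0` (Cauchy–Schwarz in `L²(dμ)`: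
`(∫ e^{-(s+t)λ} dμ)² ≤ ∫ e^{-2sλ} dμ · ∫ e^{-2tλ} dμ`). In particular `log Z` is midpoint-convex on
`[0, ∞)` and the "energy" `-(log Z)'/2` is non-increasing wherever defined. [folklore] -/
theorem PeriodicHeatFlowSpectralMeasure.sq_le_mul (hS : PeriodicHeatFlowSpectralMeasure) {N : ℕ}
    {L : ℝ} {v : ℝ → ℝ≥0∞} (hL : 0 < L) (hv : Measurable v)
    (hb : ∃ C : ℝ≥0, ∀ x, periodizedPotential v L x ≤ C) {ψ₀ : Config N → ℂ} (hψ : Measurable ψ₀)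
    (hper : ∀ (X : Config N) (i : Fin N) (k : Fin 3),
      ψ₀ (X + Pi.single i (EuclideanSpace.single k L)) = ψ₀ X)
    (h2 : ∫⁻ X in cellN N L, ‖ψ₀ X‖ₑ ^ 2 ≠ ⊤) {s t : ℝ} (hs : 0 ≤ s) (ht : 0 ≤ t) :
    (∫⁻ X in cellN N L, ‖periodicHeatFlow v N L ((s + t) / 2) ψ₀ X‖ₑ ^ 2) ^ 2 ≤
      (∫⁻ X in cellN N L, ‖periodicHeatFlow v N L s ψ₀ X‖ₑ ^ 2) *
        ∫⁻ X in cellN N L, ‖periodicHeatFlow v N L t ψ₀ X‖ₑ ^ 2 := by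
  obtain ⟨μ, _, _, _, _, hZ⟩ := hS N L v hL hv hb ψ₀ hψ hper h2
  rw [hZ _ (by positivity), hZ s hs, hZ t ht]
  -- Cauchy–Schwarz: `∫ fg ≤ (∫ f²)^{1/2} (∫ g²)^{1/2}` with `f = e^{-sE}`, `g = e^{-tE}`
  set f : ℝ → ℝ≥0∞ := fun E => ENNReal.ofReal (Real.exp (-(s * E))) with hf
  set g : ℝ → ℝ≥0∞ := fun E => ENNReal.ofReal (Real.exp (-(t * E))) with hg
  have hfm : AEMeasurable f μ :=
    (ENNReal.measurable_ofReal.comp (Real.measurable_exp.comp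
      ((measurable_const.mul measurable_id).neg))).aemeasurable
  have hgm : AEMeasurable g μ :=
    (ENNReal.measurable_ofReal.comp (Real.measurable_exp.comp
      ((measurable_const.mul measurable_id).neg))).aemeasurable
  have hfg : ∀ E, ENNReal.ofReal (Real.exp (-(2 * ((s + t) / 2) * E))) = f E * g E := by
    intro E
    rw [hf, hg, ← ENNReal.ofReal_mul (Real.exp_pos _).le, ← Real.exp_add]
    congr 1; ring
  have hf2 : ∀ E, f E ^ (2 : ℝ) = ENNReal.ofReal (Real.exp (-(2 * s * E))) := by
    intro E
    rw [hf, ENNReal.rpow_two, ← ENNReal.ofReal_pow (Real.exp_pos _).le, ← Real.exp_nat_mul]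
    congr 1; push_cast; ring
  have hg2 : ∀ E, g E ^ (2 : ℝ) = ENNReal.ofReal (Real.exp (-(2 * t * E))) := by
    intro E
    rw [hg, ENNReal.rpow_two, ← ENNReal.ofReal_pow (Real.exp_pos _).le, ← Real.exp_nat_mul]
    congr 1; push_cast; ring
  have hcs := ENNReal.lintegral_mul_le_Lp_mul_Lq μ Real.HolderConjugate.two_two hfm hgm
  simp only [Pi.mul_apply, hf2, hg2] at hcs
  simp_rw [hfg]
  calc (∫⁻ E, f E * g E ∂μ) ^ 2
      ≤ ((∫⁻ E, ENNReal.ofReal (Real.exp (-(2 * s * E))) ∂μ) ^ (1 / (2 : ℝ)) *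
          (∫⁻ E, ENNReal.ofReal (Real.exp (-(2 * t * E))) ∂μ) ^ (1 / (2 : ℝ))) ^ 2 :=
        pow_le_pow_left' hcs 2
    _ = (∫⁻ E, ENNReal.ofReal (Real.exp (-(2 * s * E))) ∂μ) *
          ∫⁻ E, ENNReal.ofReal (Real.exp (-(2 * t * E))) ∂μ := by
        rw [mul_pow, ← ENNReal.rpow_two, ← ENNReal.rpow_two, ← ENNReal.rpow_mul,
          ← ENNReal.rpow_mul]
        norm_num

end Literature.MathematicalPhysics.QuantumManyBody.BoseGas

end
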